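import Mathlib
import Summits.NavierStokesRegularity.NavierStokesRegularity.Theses.FilamentSkeletonRss
import Summits.NavierStokesRegularity.NavierStokesRegularity.Theorems.FilamentSkeletonRssSkeletonEquilibriumLineBiotSavart

/-!
# Route FilamentSkeletonRss · crux `CoreGluing` (stmt-NavierStokesRegularity-15401) — line `Sketch`, tool stub `stub_ellipticDatumRegularisedSlip`

Helper file (theorems only) supporting the crux item; lands with `--supports stmt-NavierStokesRegularity-15401`.

**The slip of the straight `C₄` configuration of the elliptic datum `D*` at finite `Γ`.** For the four
straight vortex lines `Ξ_k(σ) = √Γ P_k + σ e_k` — the `C₄` orbit (quarter turn about `e₃`) of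
`P₀ = (−2, −3/2, −2)`, `e₀ = (6,3,2)/7` — with circulations `2πΓ` (so `Γγ/4π = Γ/2`) and Leray–rotation
drift `½y − e₃ × y` (`α = 1`), the tangential component along line `0`, at `Ξ₀(τ) = √Γ P₀ + τ e₀`, of
(regularised Biot–Savart velocity of the four lines, Rosenhead core `1`) + (drift) is exactly
`√Γ · W_Γ(τ/√Γ)` with
`W_Γ(t) = t/2 − 53/28 + 2352/(9540t² − 56532t + 84329 + 9604/Γ) + 1176/(720t² − 3696t + 6664 + 2401/Γ)
  + 2352/(9540t² − 41412t + 45521 + 9604/Γ)`.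

Proof (mirrors the sibling tools file `Theorems/FilamentSkeletonRssSkeletonEquilibriumLineSlipModel.lean`,
whose private coordinate lemmas are adapted here): write `Γ = s²`, `τ = s t`, so `Ξ₀(τ) = s (P₀ + t e₀)`.
Each line integral is evaluated in closed form by the landed `SkeletonEquilibrium.Sketch.stub_lineBiotSavart`
(Lorentzian `2/(d² + 1)` times `e_k × (x − √Γ P_k)`); with `x − s P_k = s d_k`, `d_k = P₀ − P_k + t e₀`,
the `k`-th tangential component is `(s²/2) · 2/(s² q_k + 1) · s m_k` where `q_k = ‖d_k‖² − ⟨d_k, e_k⟩²`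
and `m_k = ⟨e_k × d_k, e₀⟩` are read off in coordinates (`m₀ = 0`: the self line does not slip;
`m₁ = m₃ = 12/49`, `m₂ = 24/49`; `q₁ = (9540t² − 56532t + 84329)/9604`, `q₂ = (720t² − 3696t + 6664)/2401`,
`q₃ = (9540t² − 41412t + 45521)/9604`), and the drift contributes `s (t/2 − 53/28)`
(`⟪P₀, e₀⟫ = −41/14`, `⟪e₃ × P₀, e₀⟫ = 3/7`). The rest is `field_simp; ring`.
-/

set_option linter.dupNamespace false

noncomputable section

namespace Summit.NavierStokesRegularity.NavierStokesRegularity.Theorems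

open MeasureTheory
open Literature.Analysis.FluidPDE
open scoped RealInnerProductSpace

/-- Coordinates of the inner product on `ℝ³`. [folklore] -/
private theorem rslip_inner_three (a b : EuclideanSpace ℝ (Fin 3)) :
    inner ℝ a b = a 0 * b 0 + a 1 * b 1 + a 2 * b 2 := by
  simp [PiLp.inner_apply, Fin.sum_univ_three, mul_comm]

/-- `‖a‖² = Σ aᵢ²` on `ℝ³`. [folklore] -/
private theorem rslip_norm_sq_three (a : EuclideanSpace ℝ (Fin 3)) :
    ‖a‖ ^ 2 = a 0 ^ 2 + a 1 ^ 2 + a 2 ^ 2 := by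
  rw [EuclideanSpace.real_norm_sq_eq, Fin.sum_univ_three]

/-- Coordinates of the triple product `⟨a × b, c⟩` on `ℝ³`. [folklore] -/
private theorem rslip_inner_cross_three (a b c : EuclideanSpace ℝ (Fin 3)) :
    inner ℝ (cross a b) c = (a 1 * b 2 - a 2 * b 1) * c 0 + (a 2 * b 0 - a 0 * b 2) * c 1
      + (a 0 * b 1 - a 1 * b 0) * c 2 := by
  rw [rslip_inner_three]
  simp [cross, cross_apply]

/-- `⟨u × w, u⟩ = 0`. [folklore] -/
private theorem rslip_inner_cross_self_left (u w : EuclideanSpace ℝ (Fin 3)) :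
    inner ℝ (cross u w) u = 0 := by
  rw [rslip_inner_cross_three]; ring

/-- `v × (s • d) = s • (v × d)`. [folklore] -/
private theorem rslip_cross_smul_right (v d : EuclideanSpace ℝ (Fin 3)) (s : ℝ) :
    cross v (s • d) = s • cross v d := by
  rw [← crossCLM_apply, map_smul, crossCLM_apply]

/-- The scaling skeleton of one interaction term: with `x = s A + (s t) u` and `x − s B = s d`,
`d = A − B + t u`, the tangential component `⟨c • (2/(‖x − sB‖² − ⟨x − sB, v⟩² + 1)) • v × (x − sB), u⟩`
equals `c · 2/(s² q + 1) · s m` where `q = ‖d‖² − ⟨d, v⟩²`, `m = ⟨v × d, u⟩`. [folklore] -/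
private theorem rslip_inner_term_eq (A B u v : EuclideanSpace ℝ (Fin 3)) (s t c q m : ℝ)
    (hq : ‖A - B + t • u‖ ^ 2 - (inner ℝ (A - B + t • u) v) ^ 2 = q)
    (hm : inner ℝ (cross v (A - B + t • u)) u = m) :
    inner ℝ (c • ((2 / (‖(s • A + (s * t) • u) - s • B‖ ^ 2
      - (inner ℝ ((s • A + (s * t) • u) - s • B) v) ^ 2 + 1)) • cross v ((s • A + (s * t) • u) - s • B))) u
      = c * (2 / (s ^ 2 * q + 1)) * (s * m) := by
  have hd : (s • A + (s * t) • u) - s • B = s • (A - B + t • u) := by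
    rw [smul_add, smul_sub, smul_smul]; abel
  rw [hd, norm_smul, real_inner_smul_left, mul_pow, Real.norm_eq_abs, sq_abs, rslip_cross_smul_right,
    real_inner_smul_left, real_inner_smul_left, real_inner_smul_left, hm, ← hq]
  ring

/-- The four tangents `e_k` of `D*` are unit vectors (`6² + 3² + 2² = 7²`). [folklore] -/
private theorem rslip_norm_tangent (e : Fin 4 → EuclideanSpace ℝ (Fin 3))
    (he : e = ![!₂[(6 / 7 : ℝ), (3 / 7 : ℝ), (2 / 7 : ℝ)], !₂[(-(3 / 7 : ℝ)), (6 / 7 : ℝ), (2 / 7 : ℝ)],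
      !₂[(-(6 / 7 : ℝ)), (-(3 / 7 : ℝ)), (2 / 7 : ℝ)], !₂[(3 / 7 : ℝ), (-(6 / 7 : ℝ)), (2 / 7 : ℝ)]])
    (k : Fin 4) : ‖e k‖ = 1 := by
  rw [← pow_eq_one_iff_of_nonneg (norm_nonneg _) two_ne_zero, rslip_norm_sq_three]
  subst he
  fin_cases k <;> simp <;> norm_num

/-- Line `1` seen from line `0` of `D*`: `q₁ = (9540t² − 56532t + 84329)/9604`, `m₁ = 12/49`. [folklore] -/
private theorem rslip_data_one (P e : Fin 4 → EuclideanSpace ℝ (Fin 3))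
    (hP : P = ![!₂[((-2) : ℝ), (-(3 / 2 : ℝ)), ((-2) : ℝ)], !₂[(3 / 2 : ℝ), ((-2) : ℝ), ((-2) : ℝ)],
      !₂[(2 : ℝ), (3 / 2 : ℝ), ((-2) : ℝ)], !₂[(-(3 / 2 : ℝ)), (2 : ℝ), ((-2) : ℝ)]])
    (he : e = ![!₂[(6 / 7 : ℝ), (3 / 7 : ℝ), (2 / 7 : ℝ)], !₂[(-(3 / 7 : ℝ)), (6 / 7 : ℝ), (2 / 7 : ℝ)],
      !₂[(-(6 / 7 : ℝ)), (-(3 / 7 : ℝ)), (2 / 7 : ℝ)], !₂[(3 / 7 : ℝ), (-(6 / 7 : ℝ)), (2 / 7 : ℝ)]]) (t : ℝ) :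
    ‖P 0 - P 1 + t • e 0‖ ^ 2 - (inner ℝ (P 0 - P 1 + t • e 0) (e 1)) ^ 2
        = (9540 * t ^ 2 - 56532 * t + 84329) / 9604 ∧
      inner ℝ (cross (e 1) (P 0 - P 1 + t • e 0)) (e 0) = 12 / 49 := by
  subst hP he
  rw [rslip_norm_sq_three, rslip_inner_three, rslip_inner_cross_three]
  simp
  constructor <;> ring

/-- Line `2` seen from line `0` of `D*`: `q₂ = (720t² − 3696t + 6664)/2401`, `m₂ = 24/49`. [folklore] -/
private theorem rslip_data_two (P e : Fin 4 → EuclideanSpace ℝ (Fin 3))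
    (hP : P = ![!₂[((-2) : ℝ), (-(3 / 2 : ℝ)), ((-2) : ℝ)], !₂[(3 / 2 : ℝ), ((-2) : ℝ), ((-2) : ℝ)],
      !₂[(2 : ℝ), (3 / 2 : ℝ), ((-2) : ℝ)], !₂[(-(3 / 2 : ℝ)), (2 : ℝ), ((-2) : ℝ)]])
    (he : e = ![!₂[(6 / 7 : ℝ), (3 / 7 : ℝ), (2 / 7 : ℝ)], !₂[(-(3 / 7 : ℝ)), (6 / 7 : ℝ), (2 / 7 : ℝ)],
      !₂[(-(6 / 7 : ℝ)), (-(3 / 7 : ℝ)), (2 / 7 : ℝ)], !₂[(3 / 7 : ℝ), (-(6 / 7 : ℝ)), (2 / 7 : ℝ)]]) (t : ℝ) :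
    ‖P 0 - P 2 + t • e 0‖ ^ 2 - (inner ℝ (P 0 - P 2 + t • e 0) (e 2)) ^ 2
        = (720 * t ^ 2 - 3696 * t + 6664) / 2401 ∧
      inner ℝ (cross (e 2) (P 0 - P 2 + t • e 0)) (e 0) = 24 / 49 := by
  subst hP he
  rw [rslip_norm_sq_three, rslip_inner_three, rslip_inner_cross_three]
  simp
  constructor <;> ring

/-- Line `3` seen from line `0` of `D*`: `q₃ = (9540t² − 41412t + 45521)/9604`, `m₃ = 12/49`. [folklore] -/
private theorem rslip_data_three (P e : Fin 4 → EuclideanSpace ℝ (Fin 3))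
    (hP : P = ![!₂[((-2) : ℝ), (-(3 / 2 : ℝ)), ((-2) : ℝ)], !₂[(3 / 2 : ℝ), ((-2) : ℝ), ((-2) : ℝ)],
      !₂[(2 : ℝ), (3 / 2 : ℝ), ((-2) : ℝ)], !₂[(-(3 / 2 : ℝ)), (2 : ℝ), ((-2) : ℝ)]])
    (he : e = ![!₂[(6 / 7 : ℝ), (3 / 7 : ℝ), (2 / 7 : ℝ)], !₂[(-(3 / 7 : ℝ)), (6 / 7 : ℝ), (2 / 7 : ℝ)],
      !₂[(-(6 / 7 : ℝ)), (-(3 / 7 : ℝ)), (2 / 7 : ℝ)], !₂[(3 / 7 : ℝ), (-(6 / 7 : ℝ)), (2 / 7 : ℝ)]]) (t : ℝ) :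
    ‖P 0 - P 3 + t • e 0‖ ^ 2 - (inner ℝ (P 0 - P 3 + t • e 0) (e 3)) ^ 2
        = (9540 * t ^ 2 - 41412 * t + 45521) / 9604 ∧
      inner ℝ (cross (e 3) (P 0 - P 3 + t • e 0)) (e 0) = 12 / 49 := by
  subst hP he
  rw [rslip_norm_sq_three, rslip_inner_three, rslip_inner_cross_three]
  simp
  constructor <;> ring

/-- The drift `½x − e₃ × x` at `x = s(P₀ + t e₀)` slips by `s (t/2 − 53/28)` along `e₀`
(`⟨P₀, e₀⟩ = −41/14`, `⟨e₃ × P₀, e₀⟩ = 3/7`, `⟨e₃ × e₀, e₀⟩ = 0`). [folklore] -/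
private theorem rslip_drift (P e : Fin 4 → EuclideanSpace ℝ (Fin 3))
    (hP : P = ![!₂[((-2) : ℝ), (-(3 / 2 : ℝ)), ((-2) : ℝ)], !₂[(3 / 2 : ℝ), ((-2) : ℝ), ((-2) : ℝ)],
      !₂[(2 : ℝ), (3 / 2 : ℝ), ((-2) : ℝ)], !₂[(-(3 / 2 : ℝ)), (2 : ℝ), ((-2) : ℝ)]])
    (he : e = ![!₂[(6 / 7 : ℝ), (3 / 7 : ℝ), (2 / 7 : ℝ)], !₂[(-(3 / 7 : ℝ)), (6 / 7 : ℝ), (2 / 7 : ℝ)],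
      !₂[(-(6 / 7 : ℝ)), (-(3 / 7 : ℝ)), (2 / 7 : ℝ)], !₂[(3 / 7 : ℝ), (-(6 / 7 : ℝ)), (2 / 7 : ℝ)]]) (s t : ℝ) :
    inner ℝ ((1 / 2 : ℝ) • (s • P 0 + (s * t) • e 0) - (1 : ℝ) •
      cross (EuclideanSpace.single (2 : Fin 3) (1 : ℝ)) (s • P 0 + (s * t) • e 0)) (e 0)
        = s * (t / 2 - 53 / 28) := by
  subst hP he
  rw [inner_sub_left, real_inner_smul_left, real_inner_smul_left, rslip_inner_three,
    rslip_inner_cross_three]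
  simp
  ring

/-- **The slip of the straight `C₄` configuration of `D*` at finite `Γ`.** For the four straight vortex lines
`Ξ_k(σ) = √Γ P_k + σ e_k` (the `C₄` orbit of `P₀ = (−2,−3/2,−2)`, `e₀ = (6,3,2)/7`) with circulations `2πΓ` (`Γγ/4π = Γ/2`,
i.e. `γ/2π = 1`) and Leray–rotation drift `½y − e₃×y` (`α = 1`), the tangential component along line `0` at `Ξ₀(τ)` of
(regularised Biot–Savart velocity of the four lines, core regularisation `1`, the kernel of `SkeletonEquilibrium`) + (drift) is EXACTLY
`√Γ · W_Γ(τ/√Γ)`, `W_Γ(t) = t/2 − 53/28 + 2352/(9540t² − 56532t + 84329 + 9604/Γ) + 1176/(720t² − 3696t + 6664 + 2401/Γ)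
+ 2352/(9540t² − 41412t + 45521 + 9604/Γ)` — the inner closed form `W` of `stub_ellipticDatumSlipModel` with `O(1/Γ)` core shifts
(three applications of the sibling's landed `stub_lineBiotSavart`; the self line contributes `0`). [folklore] -/
theorem stub_ellipticDatumRegularisedSlip :
    ∀ (P e : Fin 4 → EuclideanSpace ℝ (Fin 3)), P = ![!₂[((-2) : ℝ), (-(3 / 2 : ℝ)), ((-2) : ℝ)], !₂[(3 / 2 : ℝ), ((-2) : ℝ), ((-2) : ℝ)], !₂[(2 : ℝ), (3 / 2 : ℝ), ((-2) : ℝ)], !₂[(-(3 / 2 : ℝ)), (2 : ℝ), ((-2) : ℝ)]] → e = ![!₂[(6 / 7 : ℝ), (3 / 7 : ℝ), (2 / 7 : ℝ)], !₂[(-(3 / 7 : ℝ)), (6 / 7 : ℝ), (2 / 7 : ℝ)], !₂[(-(6 / 7 : ℝ)), (-(3 / 7 : ℝ)), (2 / 7 : ℝ)], !₂[(3 / 7 : ℝ), (-(6 / 7 : ℝ)), (2 / 7 : ℝ)]] →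
      ∀ (Γ τ : ℝ), 0 < Γ →
        inner ℝ ((∑ k : Fin 4, (Γ * (2 * Real.pi) / (4 * Real.pi)) • ∫ σ : ℝ, ((‖(Real.sqrt Γ • P 0 + τ • e 0) - (Real.sqrt Γ • P k + σ • e k)‖ ^ 2 + 1) ^ (3 / 2 : ℝ))⁻¹ • Literature.Analysis.FluidPDE.cross (e k) ((Real.sqrt Γ • P 0 + τ • e 0) - (Real.sqrt Γ • P k + σ • e k))) + (1 / 2 : ℝ) • (Real.sqrt Γ • P 0 + τ • e 0) - (1 : ℝ) • Literature.Analysis.FluidPDE.cross (EuclideanSpace.single (2 : Fin 3) (1 : ℝ)) (Real.sqrt Γ • P 0 + τ • e 0)) (e 0) =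
          Real.sqrt Γ * ((τ / Real.sqrt Γ) / 2 - 53 / 28 + 2352 / (9540 * (τ / Real.sqrt Γ) ^ 2 - 56532 * (τ / Real.sqrt Γ) + 84329 + 9604 / Γ) + 1176 / (720 * (τ / Real.sqrt Γ) ^ 2 - 3696 * (τ / Real.sqrt Γ) + 6664 + 2401 / Γ) + 2352 / (9540 * (τ / Real.sqrt Γ) ^ 2 - 41412 * (τ / Real.sqrt Γ) + 45521 + 9604 / Γ)) := by
  intro P e hP he Γ τ hΓ
  have hn : ∀ k, ‖e k‖ = 1 := rslip_norm_tangent e he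
  obtain ⟨s, hs, rfl⟩ : ∃ s : ℝ, 0 < s ∧ Γ = s ^ 2 :=
    ⟨Real.sqrt Γ, Real.sqrt_pos.2 hΓ, (Real.sq_sqrt hΓ.le).symm⟩
  rw [Real.sqrt_sq hs.le]
  obtain ⟨t, rfl⟩ : ∃ t : ℝ, τ = s * t := ⟨τ / s, by field_simp⟩
  have hts : s * t / s = t := by field_simp
  have hc : s ^ 2 * (2 * Real.pi) / (4 * Real.pi) = s ^ 2 / 2 := by
    have hπ : Real.pi ≠ 0 := Real.pi_ne_zero
    field_simp
    ring
  simp only [hts, hc]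
  have hI := fun k : Fin 4 =>
    (SkeletonEquilibrium.Sketch.stub_lineBiotSavart (s • P k) (e k) (s • P 0 + (s * t) • e 0) (hn k)).2
  rw [add_sub_assoc, inner_add_left, sum_inner, rslip_drift P e hP he s t]
  simp only [Fin.sum_univ_four]
  rw [hI 0, hI 1, hI 2, hI 3]
  obtain ⟨hq1, hm1⟩ := rslip_data_one P e hP he t
  obtain ⟨hq2, hm2⟩ := rslip_data_two P e hP he t
  obtain ⟨hq3, hm3⟩ := rslip_data_three P e hP he t
  rw [rslip_inner_term_eq (P 0) (P 0) (e 0) (e 0) s t _ _ 0 rfl (rslip_inner_cross_self_left _ _),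
    rslip_inner_term_eq (P 0) (P 1) (e 0) (e 1) s t _ _ _ hq1 hm1,
    rslip_inner_term_eq (P 0) (P 2) (e 0) (e 2) s t _ _ _ hq2 hm2,
    rslip_inner_term_eq (P 0) (P 3) (e 0) (e 3) s t _ _ _ hq3 hm3, mul_zero, mul_zero, zero_add]
  have hp1 : 0 < 9540 * t ^ 2 - 56532 * t + 84329 := by nlinarith [sq_nonneg (9540 * t - 28266)]
  have hp2 : 0 < 720 * t ^ 2 - 3696 * t + 6664 := by nlinarith [sq_nonneg (720 * t - 1848)]
  have hp3 : 0 < 9540 * t ^ 2 - 41412 * t + 45521 := by nlinarith [sq_nonneg (9540 * t - 20706)]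
  field_simp
  ring

end Summit.NavierStokesRegularity.NavierStokesRegularity.Theorems
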